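import Summits.BirchSwinnertonDyer.BirchSwinnertonDyer.Theorems.BiquadraticEisensteinDescentHeegnerTwistCouplingInSupplyQuarticPartnerDescent
import HarnessLib

set_option linter.dupNamespace false -- `Summit.BirchSwinnertonDyer.BirchSwinnertonDyer.Theorems.…` (summit = sub)
set_option autoImplicit false

/-!
# Crux `HeegnerTwistCouplingInSupply` (stmt-BirchSwinnertonDyer-21381) — the QUARTIC `j = 1728` corner with a SYMBOLIC PARTNER, IIa:
# Euler's criterion for `r ≡ 5 (mod 8)`, anisotropy of the reduced forms at `r`, reciprocity bookkeeping

Route `BiquadraticEisensteinDescent` (cell `pub/bsd-wall`, width seat `bsd-wall-cm-bed-w4` g13; `--supports` 21381, helper). Tools for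
the dual side `S(0, 4r²pq²)` of the partner descent (`…QuarticPartnerDescentDual`): for `r = 8k + 5` a non-residue `a` has
`(a^{k+1})⁴ = −a²` and a residue `(a^{k+1})⁴ = a²` (Euler's criterion, `(r−1)/2 = 4k+2`), so `−4q² = ((2q)^{k+1})⁴` when `(q/r) = +1`
(`2 ∉ 𝔽_r^{×2}`) and `−q² = (q^{k+1})⁴` when `(q/r) = −1`; each of the four reduced forms `x⁴ + 4pq²y⁴`, `px⁴ + 4q²y⁴`,
`2x⁴ + 2pq²y⁴`, `2px⁴ + 2q²y⁴` then reduces to `x⁴ = p·z⁴`, impossible for `p ∉ 𝔽_r^{×4}` (`anisotropic_partner_dual`).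
Reciprocity (`r ≡ 1 (mod 4)`): `(p/r) = (r/p)`, `(r/q) = (q/r)`.

HONEST FRAMING: tools for a typed sub-corner on one CM family; the crux (residual C⁺) is untouched; BSD is not proved by any of
this. THEOREMS ONLY. Supports stmt-BirchSwinnertonDyer-21381.
-/

noncomputable section

open scoped Classical

namespace Summit.BirchSwinnertonDyer.BirchSwinnertonDyer.Theorems.BiquadraticEisensteinDescentHeegnerTwistCouplingInSupplyQuarticPartnerEuler

open Literature.NumberTheory.EllipticCurves Literature.NumberTheory.EllipticCurves.XCubeAddPX
  Summit.BirchSwinnertonDyer.BirchSwinnertonDyer.Theorems.BiquadraticEisensteinDescentHeegnerTwistCouplingInSupplyQuarticTwistLocal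
  Summit.BirchSwinnertonDyer.BirchSwinnertonDyer.Theorems.BiquadraticEisensteinDescentHeegnerTwistCouplingInSupplyQuarticTwistDescent
  Summit.BirchSwinnertonDyer.BirchSwinnertonDyer.Theorems.BiquadraticEisensteinDescentHeegnerTwistCouplingInSupplyQuarticTwistDescentDual
  Summit.BirchSwinnertonDyer.BirchSwinnertonDyer.Theorems.BiquadraticEisensteinDescentHeegnerTwistCouplingInSupplyQuarticPartnerDescent

/-! ## §1 Euler's criterion for `r ≡ 5 (mod 8)` and the anisotropy of the four reduced forms at `r` -/

section Euler

variable {p q r : ℕ} [hr : Fact r.Prime]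

/-- **Euler's criterion, fourth-power form, `r = 8k + 5`**: for `a ≠ 0` in `𝔽_r`, `(a^{k+1})⁴ = a²` if `a` is a square and
`(a^{k+1})⁴ = −a²` if not (`a^{(r−1)/2} = ±1`, `(r−1)/2 = 4k + 2`). [folklore] -/
theorem pow_fourth_eq_of_mod_eight (hr8 : r % 8 = 5) {a : ZMod r} (ha : a ≠ 0) :
    (IsSquare a → (a ^ (r / 8 + 1)) ^ 4 = a ^ 2) ∧ (¬ IsSquare a → (a ^ (r / 8 + 1)) ^ 4 = -a ^ 2) := by
  have hexp : (r / 8 + 1) * 4 = r / 2 + 2 := by omega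
  have key : (a ^ (r / 8 + 1)) ^ 4 = a ^ (r / 2) * a ^ 2 := by
    rw [← pow_mul, hexp, pow_add]
  constructor
  · intro hsq
    rw [key, (ZMod.euler_criterion r ha).mp hsq, one_mul]
  · intro hnsq
    rcases ZMod.pow_div_two_eq_neg_one_or_one r ha with h1 | h1
    · exact absurd ((ZMod.euler_criterion r ha).mpr h1) hnsq
    · rw [key, h1]; ring

/-- `x⁴ = p·z⁴` in `𝔽_r` with `p ∉ 𝔽_r^{×4}` forces `x = z = 0`. [folklore] -/
theorem eq_zero_of_fourth_eq (hp4 : ∀ t : ZMod r, t ^ 4 ≠ ((p : ℤ) : ZMod r)) {x z : ZMod r}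
    (h : x ^ 4 = ((p : ℤ) : ZMod r) * z ^ 4) : x = 0 ∧ z = 0 := by
  by_cases hz : z = 0
  · rw [hz, zero_pow four_ne_zero, mul_zero] at h
    exact ⟨pow_eq_zero_iff four_ne_zero |>.mp h, hz⟩
  · exfalso
    apply hp4 (x / z)
    rw [div_pow, h, mul_div_assoc, div_self (pow_ne_zero 4 hz), mul_one]

/-- **The four reduced forms at `r` are anisotropic** (`p ∉ 𝔽_r^{×4}`, `2 ∉ 𝔽_r^{×2}`, `r ∤ 2q`): `x⁴ + 4pq²y⁴` and `p·x⁴ + 4q²y⁴` when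
`q ∈ 𝔽_r^{×2}` (then `−4q² = ((2q)^{k+1})⁴`), `2x⁴ + 2pq²y⁴` and `2p·x⁴ + 2q²y⁴` when `q ∉ 𝔽_r^{×2}` (then `−q² = (q^{k+1})⁴`).
[folklore] -/
theorem anisotropic_partner_dual (hr8 : r % 8 = 5) (hq0 : ((q : ℤ) : ZMod r) ≠ 0) (h2 : ¬ IsSquare ((2 : ℤ) : ZMod r))
    (hp4 : ∀ t : ZMod r, t ^ 4 ≠ ((p : ℤ) : ZMod r)) :
    (IsSquare ((q : ℤ) : ZMod r) →
      (∀ x y : ZMod r, ((1 : ℤ) : ZMod r) * x ^ 4 + ((4 * p * q ^ 2 : ℤ) : ZMod r) * y ^ 4 = 0 → x = 0 ∧ y = 0) ∧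
      (∀ x y : ZMod r, ((p : ℤ) : ZMod r) * x ^ 4 + ((4 * q ^ 2 : ℤ) : ZMod r) * y ^ 4 = 0 → x = 0 ∧ y = 0)) ∧
    (¬ IsSquare ((q : ℤ) : ZMod r) →
      (∀ x y : ZMod r, ((2 : ℤ) : ZMod r) * x ^ 4 + ((2 * p * q ^ 2 : ℤ) : ZMod r) * y ^ 4 = 0 → x = 0 ∧ y = 0) ∧
      (∀ x y : ZMod r, ((2 * p : ℤ) : ZMod r) * x ^ 4 + ((2 * q ^ 2 : ℤ) : ZMod r) * y ^ 4 = 0 → x = 0 ∧ y = 0)) := by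
  have h20 : ((2 : ℤ) : ZMod r) ≠ 0 := fun h0 => h2 ⟨0, by rw [h0, mul_zero]⟩
  constructor
  · intro hsq
    -- `t = (2q)^{k+1}`, `t⁴ = −4q²`
    have h2q : ¬ IsSquare (((2 : ℤ) : ZMod r) * ((q : ℤ) : ZMod r)) := not_isSquare_mul_of_isSquare h2 hsq hq0
    have h2q0 : ((2 : ℤ) : ZMod r) * ((q : ℤ) : ZMod r) ≠ 0 := mul_ne_zero h20 hq0
    have ht := (pow_fourth_eq_of_mod_eight hr8 h2q0).2 h2q
    set t := (((2 : ℤ) : ZMod r) * ((q : ℤ) : ZMod r)) ^ (r / 8 + 1) with ht_def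
    have ht0 : t ≠ 0 := pow_ne_zero _ h2q0
    constructor
    · intro x y h
      have h' : x ^ 4 = ((p : ℤ) : ZMod r) * (t * y) ^ 4 := by
        rw [mul_pow, ht]; push_cast at h ⊢; linear_combination h
      obtain ⟨hx, hty⟩ := eq_zero_of_fourth_eq hp4 h'
      exact ⟨hx, (mul_eq_zero.mp hty).resolve_left ht0⟩
    · intro x y h
      have h' : (t * y) ^ 4 = ((p : ℤ) : ZMod r) * x ^ 4 := by
        rw [mul_pow, ht]; push_cast at h ⊢; linear_combination -h
      obtain ⟨hty, hx⟩ := eq_zero_of_fourth_eq hp4 h'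
      exact ⟨hx, (mul_eq_zero.mp hty).resolve_left ht0⟩
  · intro hnsq
    -- `s = q^{k+1}`, `s⁴ = −q²`
    have hs := (pow_fourth_eq_of_mod_eight hr8 hq0).2 hnsq
    set s := ((q : ℤ) : ZMod r) ^ (r / 8 + 1) with hs_def
    have hs0 : s ≠ 0 := pow_ne_zero _ hq0
    have h20' : (2 : ZMod r) ≠ 0 := by simpa using h20
    constructor
    · intro x y h
      have h' : x ^ 4 = ((p : ℤ) : ZMod r) * (s * y) ^ 4 := by
        rw [mul_pow, hs]
        push_cast at h ⊢
        have := mul_left_cancel₀ h20' (show ((2 : ZMod r)) * (x ^ 4 + (p : ZMod r) * (q : ZMod r) ^ 2 * y ^ 4) = 2 * 0 by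
          linear_combination h)
        linear_combination this
      obtain ⟨hx, hsy⟩ := eq_zero_of_fourth_eq hp4 h'
      exact ⟨hx, (mul_eq_zero.mp hsy).resolve_left hs0⟩
    · intro x y h
      have h' : (s * y) ^ 4 = ((p : ℤ) : ZMod r) * x ^ 4 := by
        rw [mul_pow, hs]
        push_cast at h ⊢
        have := mul_left_cancel₀ h20' (show ((2 : ZMod r)) * ((p : ZMod r) * x ^ 4 + (q : ZMod r) ^ 2 * y ^ 4) = 2 * 0 by
          linear_combination h)
        linear_combination -this
      obtain ⟨hsy, hx⟩ := eq_zero_of_fourth_eq hp4 h'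
      exact ⟨hx, (mul_eq_zero.mp hsy).resolve_left hs0⟩

end Euler

/-! ## §2 Residues modulo `r` and modulo `q` (reciprocity: `(p/r) = (r/p)`, `(r/q) = (q/r)`) -/

section Residues

variable {p q r : ℕ} [hp : Fact p.Prime] [hq : Fact q.Prime] [hr : Fact r.Prime]

omit hq in
/-- `(p/r) = (r/p) = +1` for `r ≡ 1 (mod 4)`: `p` is a residue mod `r`. [folklore] -/
theorem isSquare_p_mod_partner (hr4 : r % 4 = 1) (hp2 : p ≠ 2) (hrp : r ≠ p) (hsr : IsSquare ((r : ℤ) : ZMod p)) :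
    IsSquare ((p : ℤ) : ZMod r) := by
  have hr0 : ((r : ℤ) : ZMod p) ≠ 0 := by
    intro h0
    have : (p : ℤ) ∣ r := (ZMod.intCast_zmod_eq_zero_iff_dvd r p).mp h0
    have : p ∣ r := by exact_mod_cast this
    exact hrp ((Nat.prime_dvd_prime_iff_eq hp.out hr.out).mp this).symm
  have hp0 : ((p : ℤ) : ZMod r) ≠ 0 := by
    intro h0
    have : (r : ℤ) ∣ p := (ZMod.intCast_zmod_eq_zero_iff_dvd p r).mp h0
    have : r ∣ p := by exact_mod_cast this
    exact hrp ((Nat.prime_dvd_prime_iff_eq hr.out hp.out).mp this)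
  have h1 : legendreSym p r = 1 := (legendreSym.eq_one_iff p hr0).mpr hsr
  have hrec := legendreSym.quadratic_reciprocity_one_mod_four (p := r) (q := p) hr4 hp2
  exact (legendreSym.eq_one_iff r hp0).mp (by rw [← hrec, h1])

omit hp in
/-- `(r/q) = (q/r)` for `r ≡ 1 (mod 4)`, in `IsSquare` form (both directions). [folklore] -/
theorem isSquare_partner_mod_q_iff (hr4 : r % 4 = 1) (hq2 : q ≠ 2) (hrq : r ≠ q) :
    IsSquare ((r : ℤ) : ZMod q) ↔ IsSquare ((q : ℤ) : ZMod r) := by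
  have hr0 : ((r : ℤ) : ZMod q) ≠ 0 := by
    intro h0
    have : (q : ℤ) ∣ r := (ZMod.intCast_zmod_eq_zero_iff_dvd r q).mp h0
    have : q ∣ r := by exact_mod_cast this
    exact hrq ((Nat.prime_dvd_prime_iff_eq hq.out hr.out).mp this).symm
  have hq0 : ((q : ℤ) : ZMod r) ≠ 0 := by
    intro h0
    have : (r : ℤ) ∣ q := (ZMod.intCast_zmod_eq_zero_iff_dvd q r).mp h0
    have : r ∣ q := by exact_mod_cast this
    exact hrq ((Nat.prime_dvd_prime_iff_eq hr.out hq.out).mp this)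
  have hrec := legendreSym.quadratic_reciprocity_one_mod_four (p := r) (q := q) hr4 hq2
  rw [← legendreSym.eq_one_iff q hr0, ← legendreSym.eq_one_iff r hq0, hrec]

omit hp hq in
/-- `2` is a non-residue mod `r ≡ 5 (mod 8)`. [folklore] -/
theorem not_isSquare_two_mod_partner (hr8 : r % 8 = 5) : ¬ IsSquare ((2 : ℤ) : ZMod r) := by
  push_cast
  rw [ZMod.exists_sq_eq_two_iff (by rintro rfl; omega)]
  omega

end Residues

end Summit.BirchSwinnertonDyer.BirchSwinnertonDyer.Theorems.BiquadraticEisensteinDescentHeegnerTwistCouplingInSupplyQuarticPartnerEuler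

end
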